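import Literature.Analysis.FluidPDE.NSCriticalClosureOfHigherRegularity
import Literature.Analysis.FluidPDE.NSBoundedHigherRegularityQuantProofs
import HarnessLib

/-!
# `ess_sup_bound_holds`: Escauriaza–Seregin–Šverák's boundedness away from `t = 0` (ESS 2003, §3 (3.5)–(3.6))

Analysis/FluidPDE proof file (theorems only: no definition, no named fact, no `sorry`).  It composes
reductions that are already in the tree with `NSBoundedHigherRegularityBounds_holds`
(`NSBoundedHigherRegularityQuantProofs.lean`: the quantitative higher-regularity bounds for bounded
distributional Navier–Stokes solutions, Seregin–Šverák 2009, §2 p. 8 = Serrin's interior regularity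
with constants, proved by the Serrin bootstrap `NSBootstrap*.lean`), which was the last open
hypothesis of each reduction used below.  No statement is changed; each `X_holds : X` turns the
named fact `X` from literature debt into a theorem.
-/

namespace Literature.Analysis.FluidPDE

/-- **ESS 2003, §3 (3.5)–(3.6) (boundedness away from `t = 0`), proved**: `ess_sup_bound` holds — `ess_sup_bound_of_higherRegularityBounds` (NSCriticalClosureOfHigherRegularity.lean) fed with `NSBoundedHigherRegularityBounds_holds`.
[cite: EscauriazaSereginSverak2003, §3 (3.5)–(3.6)] -/
theorem ess_sup_bound_holds : ess_sup_bound :=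
  ess_sup_bound_of_higherRegularityBounds NSBoundedHigherRegularityBounds_holds

end Literature.Analysis.FluidPDE
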